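import Literature.AnabelianGeometry.EtaleTheta.Discharge.Sec2Cor28iInnerOfEmbedding
import HarnessLib

/-!
# [EtTh] Cor 2.8 (i)/(iii): the automorphism of the cyclotome `Δ_Θ = top/bot` INDUCED by an inner
# automorphism exists (it is the conjugation action `act x`) — and the unconditional inner clause 1 of
# Cor 2.8 (iii) for `ThetaOrbitData.ofEmbedding`

Mochizuki, *The Étale Theta Function …* [EtTh], Publ. RIMS 45 (2009) (refereed), §2, Cor 2.8 (i), (iii), PRIMS
PDF p.41 (last lines) – p.42 (printed pp.267–268; bib key `MochizukiEtTh2009`; own render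
`paper:doi-10-2977-prims-1234361159` p0041/p0042): «Corollary 2.8 (Constant Multiple Rigidity of Roots of the Étale
Theta Function). For `□ = α, β`, let us assume that we have smooth log orbicurves as in the above discussion, over a
finite extension `K_□` of `ℚ_p`. Let `γ : Π^tp_{X̲̲α} ⥲ Π^tp_{X̲̲β}` (respectively, …) be an isomorphism of topological
groups. Then: (i) The isomorphism `γ` preserves the property [cf. Theorem 1.6, (iii)] that `η̲̈^{Θ,l·ℤ×μ₂}`
(respectively, …) be of standard type — a property that determines this collection of classes up to multiplication
by a root of unity of order `l` (respectively, 1; `l`; 1)»; «(iii) If the data for `□ = α, β` are equal, and `γ`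
arises [cf. Proposition 2.6] from an inner automorphism of `Π^tp_{Ẋ̲̲}` (respectively, …), then `γ` preserves
`η̲̈^{Θ,l·ℤ}` (respectively, …) [i.e., without any constant multiple indeterminacy]»; proof, p.42: «… assertion (i)
follows immediately from Theorem 1.10, (i), and the definitions; … assertion (iii) follows immediately from
Remark 1.9.1.»  The phrase «`γ` induces an automorphism `Γ_Θ` of the subquotient `Δ_Θ = top/bot`» used in this file
is abc-iut-L2-t2's TYPED READING (`ThetaOrbitData.InducesOnTheta`, `ThetaRootOrbits.lean`) of how such a `γ` acts on
the coefficient cyclotome, NOT a printed sentence; print's mechanism is the proof of Prop 2.4, p.39 (render p0039):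
«`γ` induces an isomorphism `Π^tp_{Cα} ⥲ Π^tp_{Cβ}` … which … induces an isomorphism `Δ^tp_{Cα} ⥲ Δ^tp_{Cβ}`;
moreover, this last isomorphism induces … an isomorphism `Δ^tp_{Xα} ⥲ Δ^tp_{Xβ}`, hence also [by considering the
conjugation action of `Π^tp_C` on an appropriate abelian quotient …] …».  (DOC-ERRATUM, header only — abc-iut-f-193
gen 15 for the abc-iut-L2-t2 lineage, abc-iut-L2-lead R1422, after abc-iut-ref-z's SPILLOVER NOTE
2026-08-27T10:05:06Z: v1 of this header (p428657) carried the paraphrase «`γ` … induces an automorphism of [the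
subquotient] `Δ_Θ`» INSIDE quotation marks, and a Cor 2.8 (iii) quote with unmarked drops («If the data for
`□ = α, β` are equal, and», «[cf. Proposition 2.6]», the «respectively» lists); both replaced here by
verbatim-or-marked print.  ALL DECLARATIONS, their docstrings and proofs are BYTE-IDENTICAL to v1.)

PROOF-ONLY companion (no `def`; seat abc-iut-L2-t2) of `ThetaRootOrbits.lean`. GENERIC over the
interface `ThetaCovers.ThetaOrbitData O` (any `T : TemperedCoverData l`): since `top`, `bot` are normal in
`Π^tp_C`, the inner automorphism `γ_x` (`ThetaOrbitData.innerAutTop x`) stabilises `top`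
(`map_innerAutTop_eq_of_normal`) and INDUCES on `top/bot` the conjugation action `O.act x`, which is a
group automorphism with inverse `O.act x⁻¹` — `exists_inducesOnTheta_innerAutTop : ∃ Γ_Θ,
O.InducesOnTheta (innerAutTop x) Γ_Θ ∧ ∀ a, Γ_Θ a = O.act x a` (non-vacuity of the relation
`InducesOnTheta` in the inner case; `Γ_Θ` is unique on `top/bot` by the defining formula). Consequence for
the §1-model orbit data (`ThetaRootOrbitsOfSetting`, `Sec2Cor28iiiInnerOfEmbedding`,
`Sec2Cor28iInnerOfEmbedding`): `ofEmbedding_inner_preserves_rootLZ` — for EVERY `x ∈ Π^tp_{X̲̲} ∩ Π^tp_Ċ`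
of `T` there exist the induced `Γ_Θ` and the stability witness of `Π^tp_{Ÿ̲̲}`, and
`(γ_x, Γ_Θ)·η̲̈^{Θ,l·ℤ} = η̲̈^{Θ,l·ℤ}` — clause 1 of Cor 2.8 (iii) with all its side data DISCHARGED; and
`ofEmbedding_inner_cor28_i` — for EVERY `x ∈ Π^tp_{X̲̲}` of `T`, the induced `Γ_Θ` and both stability
witnesses exist and all four conclusions of `Cor28_i` hold (given standard type). HONEST FRAMING: [EtTh] is refereed; no side is taken on
[IUTchIII] Cor 3.12; nothing beyond the displayed statements is claimed.
-/

noncomputable section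

namespace Literature.AnabelianGeometry.EtaleTheta

open Literature.AnabelianGeometry.SemiGraphs ThetaCovers

universe u

namespace ThetaCovers.ThetaOrbitData

section generic

variable {l : ℕ} {T : TemperedCoverData.{u} l} (O : ThetaOrbitData T)

/-- The inner automorphism `γ_x` is conjugation: `γ_x(g) = x g x⁻¹`. [cite: MochizukiEtTh2009, Cor 2.8(iii) p.42] -/
theorem innerAutTop_apply (x g : T.Gtp) : innerAutTop x g = x * g * x⁻¹ := rfl

/-- An inner automorphism stabilises every normal subgroup of `Π^tp_C`.
[cite: MochizukiEtTh2009, Cor 2.8(iii) p.42] -/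
theorem map_innerAutTop_eq_of_normal (N : Subgroup T.Gtp) [hN : N.Normal] (x : T.Gtp) :
    N.map (innerAutTop x).toMulEquiv.toMonoidHom = N := by
  ext y
  constructor
  · rintro ⟨t, ht, rfl⟩
    exact hN.conj_mem t ht x
  · intro hy
    refine ⟨x⁻¹ * y * x, ?_, ?_⟩
    · have h := hN.conj_mem y hy x⁻¹
      rwa [inv_inv] at h
    · show x * (x⁻¹ * y * x) * x⁻¹ = y
      group

/-- `act x⁻¹` undoes `act x` on `top/bot`. [cite: MochizukiEtTh2009, Cor 2.8(i) p.42] -/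
theorem act_inv_act (x : T.Gtp) (a : O.DeltaTheta) : O.act x⁻¹ (O.act x a) = a := by
  haveI := O.top_normal
  induction a using QuotientGroup.induction_on with
  | H t =>
    show (QuotientGroup.mk (MulAut.conjNormal x⁻¹ (MulAut.conjNormal x t)) : O.DeltaTheta) =
      QuotientGroup.mk t
    rw [← MulAut.mul_apply, ← map_mul, inv_mul_cancel, map_one, MulAut.one_apply]

/-- `act x` undoes `act x⁻¹` on `top/bot`. [cite: MochizukiEtTh2009, Cor 2.8(i) p.42] -/
theorem act_act_inv (x : T.Gtp) (a : O.DeltaTheta) : O.act x (O.act x⁻¹ a) = a := by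
  have h := O.act_inv_act x⁻¹ a
  rwa [inv_inv] at h

/-- **The induced automorphism of `Δ_Θ = top/bot` exists for inner automorphisms** and is the
conjugation action: `∃ Γ_Θ, InducesOnTheta (γ_x) Γ_Θ ∧ Γ_Θ = act x` (for ANY orbit datum `O`).
[cite: MochizukiEtTh2009, Cor 2.8(i) p.42] -/
theorem exists_inducesOnTheta_innerAutTop (x : T.Gtp) :
    ∃ ΓΘ : O.DeltaTheta ≃* O.DeltaTheta, O.InducesOnTheta (innerAutTop x) ΓΘ ∧ ∀ a, ΓΘ a = O.act x a := by
  haveI := O.top_normal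
  refine ⟨MulEquiv.mk' ⟨O.act x, O.act x⁻¹, O.act_inv_act x, O.act_act_inv x⟩ (map_mul (O.act x)),
    ⟨map_innerAutTop_eq_of_normal O.top x, fun d => rfl⟩, fun a => rfl⟩

/-- In particular the relation `InducesOnTheta (γ_x) Γ_Θ` pins `Γ_Θ` down: any induced `Γ_Θ` agrees with
`act x`. [cite: MochizukiEtTh2009, Cor 2.8(i) p.42] -/
theorem inducesOnTheta_innerAutTop_eq_act {x : T.Gtp} {ΓΘ : O.DeltaTheta ≃* O.DeltaTheta}
    (h : O.InducesOnTheta (innerAutTop x) ΓΘ) (a : O.DeltaTheta) : ΓΘ a = O.act x a := by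
  haveI := O.top_normal
  obtain ⟨hΓ, hind⟩ := h
  induction a using QuotientGroup.induction_on with
  | H t => exact hind t

end generic

/-! ### The unconditional inner clause 1 of Cor 2.8 (iii) for `ofEmbedding` -/

variable {p : ℕ} [Fact p.Prime] {D : ThetaSetting p} {E : D.EtaleThetaData} {l : ℕ}
  {C : E.DoubleUnderline l} {T : TemperedCoverData.{u} l} (ε : C.OrbitEmbedding T)

/-- For `x ∈ ι(Π^tp_{X̲̲})` (`= Π^tp_{X̲̲}` of `T`), `γ_x` stabilises `Π^tp_{Ÿ̲̲} = T.PiYddtp ∩ Π^tp_{X̲̲}`.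
[cite: MochizukiEtTh2009, Def 2.7 p.41] -/
theorem map_innerAutTop_PiYdduu (hC : D.Compat) {x : T.Gtp} (hx : x ∈ C.Huu.map ε.ι) :
    (T.PiYddtp ⊓ T.tp T.PiXuu).map (innerAutTop x).toMulEquiv.toMonoidHom = T.PiYddtp ⊓ T.tp T.PiXuu := by
  haveI := hC.GtpYdd_normal
  obtain ⟨σ, hσ, rfl⟩ := Subgroup.mem_map.1 hx
  ext y
  constructor
  · rintro ⟨t, ht, rfl⟩
    exact ε.conj_mem_PiYdduu hσ ⟨t, ht⟩
  · intro hy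
    refine ⟨(ε.ι σ)⁻¹ * y * ε.ι σ, ε.inv_conj_mem_PiYdduu hσ ⟨y, hy⟩, ?_⟩
    show ε.ι σ * ((ε.ι σ)⁻¹ * y * ε.ι σ) * (ε.ι σ)⁻¹ = y
    group

/-- **Cor 2.8 (iii), clause 1, with its side data discharged**: for EVERY `x ∈ Π^tp_{X̲̲} ∩ Π^tp_Ċ` of `T`
there are the induced `Γ_Θ` (`= act x`) and the stability witness of `Π^tp_{Ÿ̲̲}`, and the transport of
`η̲̈^{Θ,l·ℤ}` by `(γ_x, Γ_Θ)` is `η̲̈^{Θ,l·ℤ}`. [cite: MochizukiEtTh2009, Cor 2.8(iii) p.42] -/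
theorem ofEmbedding_inner_preserves_rootLZ (hC : D.Compat) (hS : D.Sec2Hyps) {x : T.Gtp}
    (hx : x ∈ T.tp T.PiXuu ⊓ T.PiCdot) :
    ∃ (ΓΘ : (ofEmbedding ε hC hS).DeltaTheta ≃* (ofEmbedding ε hC hS).DeltaTheta)
      (hYuu : (T.PiYddtp ⊓ T.tp T.PiXuu).map (innerAutTop x).toMulEquiv.toMonoidHom =
        T.PiYddtp ⊓ T.tp T.PiXuu),
      (ofEmbedding ε hC hS).InducesOnTheta (innerAutTop x) ΓΘ ∧
      (∀ a, ΓΘ a = (ofEmbedding ε hC hS).act x a) ∧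
      (ofEmbedding ε hC hS).transport _ (innerAutTop x) hYuu ΓΘ (ofEmbedding ε hC hS).rootLZ =
        (ofEmbedding ε hC hS).rootLZ := by
  obtain ⟨ΓΘ, hind, hact⟩ := (ofEmbedding ε hC hS).exists_inducesOnTheta_innerAutTop x
  exact ⟨ΓΘ, map_innerAutTop_PiYdduu ε hC (ε.map_Huu.ge (Subgroup.mem_inf.1 hx).1), hind, hact,
    ofEmbedding_transport_inner_rootLZ ε hC hS hx ΓΘ hind _⟩

/-- Likewise for `η̲̈^{Θ,l·ℤ×μ₂}` and every `x ∈ Π^tp_{X̲̲}` of `T` (no dottedness needed).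
[cite: MochizukiEtTh2009, Def 2.7 p.41] -/
theorem ofEmbedding_inner_preserves_rootLZMu2 (hC : D.Compat) (hS : D.Sec2Hyps) {x : T.Gtp}
    (hx : x ∈ T.tp T.PiXuu) :
    ∃ (ΓΘ : (ofEmbedding ε hC hS).DeltaTheta ≃* (ofEmbedding ε hC hS).DeltaTheta)
      (hYuu : (T.PiYddtp ⊓ T.tp T.PiXuu).map (innerAutTop x).toMulEquiv.toMonoidHom =
        T.PiYddtp ⊓ T.tp T.PiXuu),
      (ofEmbedding ε hC hS).InducesOnTheta (innerAutTop x) ΓΘ ∧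
      (∀ a, ΓΘ a = (ofEmbedding ε hC hS).act x a) ∧
      (ofEmbedding ε hC hS).transport _ (innerAutTop x) hYuu ΓΘ (ofEmbedding ε hC hS).rootLZMu2 =
        (ofEmbedding ε hC hS).rootLZMu2 := by
  obtain ⟨ΓΘ, hind, hact⟩ := (ofEmbedding ε hC hS).exists_inducesOnTheta_innerAutTop x
  exact ⟨ΓΘ, map_innerAutTop_PiYdduu ε hC (ε.map_Huu.ge hx), hind, hact,
    ofEmbedding_transport_inner_rootLZMu2 ε hC hS hx ΓΘ hind _⟩

/-- For `x ∈ ι(Π^tp_X)`, `γ_x` stabilises `T.PiYddtp = ι(Π^tp_Ÿ)` (`Π^tp_Ÿ ⊴ Π^tp_X`).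
[cite: MochizukiEtTh2009, Def 2.7 p.41] -/
theorem map_innerAutTop_PiYddtp (hC : D.Compat) {x : T.Gtp} (hx : x ∈ (⊤ : Subgroup D.PiTemp).map ε.ι) :
    T.PiYddtp.map (innerAutTop x).toMulEquiv.toMonoidHom = T.PiYddtp := by
  haveI := hC.GtpYdd_normal
  obtain ⟨σ, -, rfl⟩ := Subgroup.mem_map.1 hx
  ext y
  constructor
  · rintro ⟨t, ht, rfl⟩
    exact ε.conj_mem_PiYddtp σ ⟨t, ht⟩
  · intro hy
    refine ⟨(ε.ι σ)⁻¹ * y * ε.ι σ, ε.inv_conj_mem_PiYddtp σ ⟨y, hy⟩, ?_⟩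
    show ε.ι σ * ((ε.ι σ)⁻¹ * y * ε.ι σ) * (ε.ι σ)⁻¹ = y
    group

/-- **Cor 2.8 (i), INNER case, with its side data discharged**: for EVERY `x ∈ Π^tp_{X̲̲}` of `T`, the
induced `Γ_Θ` (`= act x`) and the stability witnesses of `Π^tp_Ÿ`, `Π^tp_{Ÿ̲̲}` exist, and — given that
`η̈^{Θ,ℤ×μ₂}` is of standard type — all four conclusions of `ThetaOrbitData.Cor28_i` hold for `(γ_x, Γ_Θ)`.
[cite: MochizukiEtTh2009, Cor 2.8(i) p.42] -/
theorem ofEmbedding_inner_cor28_i (hC : D.Compat) (hS : D.Sec2Hyps)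
    (hstd : (ofEmbedding ε hC hS).IsStandard) {x : T.Gtp} (hx : x ∈ T.tp T.PiXuu) :
    ∃ (ΓΘ : (ofEmbedding ε hC hS).DeltaTheta ≃* (ofEmbedding ε hC hS).DeltaTheta)
      (hY : T.PiYddtp.map (innerAutTop x).toMulEquiv.toMonoidHom = T.PiYddtp)
      (hYuu : (T.PiYddtp ⊓ T.tp T.PiXuu).map (innerAutTop x).toMulEquiv.toMonoidHom =
        T.PiYddtp ⊓ T.tp T.PiXuu),
      (ofEmbedding ε hC hS).InducesOnTheta (innerAutTop x) ΓΘ ∧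
      (∀ a, ΓΘ a = (ofEmbedding ε hC hS).act x a) ∧
      (ofEmbedding ε hC hS).IsStandardColl
          ((ofEmbedding ε hC hS).transport _ (innerAutTop x) hY ΓΘ (ofEmbedding ε hC hS).etaZMu2) ∧
      (ofEmbedding ε hC hS).EqUpToRootOfUnity l _ (ofEmbedding ε hC hS).rootLZMu2
          ((ofEmbedding ε hC hS).transport _ (innerAutTop x) hYuu ΓΘ (ofEmbedding ε hC hS).rootLZMu2) ∧
      (ofEmbedding ε hC hS).EqUpToRootOfUnity 1 _ (ofEmbedding ε hC hS).etaZMu2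
          ((ofEmbedding ε hC hS).transport _ (innerAutTop x) hY ΓΘ (ofEmbedding ε hC hS).etaZMu2) ∧
      (ofEmbedding ε hC hS).EqUpToRootOfUnity 1 _ (ofEmbedding ε hC hS).etaLZMu2
          ((ofEmbedding ε hC hS).transport _ (innerAutTop x) hY ΓΘ (ofEmbedding ε hC hS).etaLZMu2) := by
  obtain ⟨ΓΘ, hind, hact⟩ := (ofEmbedding ε hC hS).exists_inducesOnTheta_innerAutTop x
  have hxX : x ∈ (⊤ : Subgroup D.PiTemp).map ε.ι := Subgroup.map_mono le_top (ε.map_Huu.ge hx)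
  exact ⟨ΓΘ, map_innerAutTop_PiYddtp ε hC hxX, map_innerAutTop_PiYdduu ε hC (ε.map_Huu.ge hx), hind, hact,
    ofEmbedding_cor28_i_inner ε hC hS hstd hx ΓΘ hind _ _⟩

end ThetaCovers.ThetaOrbitData

end Literature.AnabelianGeometry.EtaleTheta

end
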